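import Summits.ResolutionOfSingularities.ResolutionOfSingularities.Theorems.FrobeniusClosingPatchingRelPerfectDepthSNCExchange
import Summits.ResolutionOfSingularities.ResolutionOfSingularities.Theorems.FrobeniusClosingPatchingRelPerfectDepthSNCPointwiseTransport
import Literature.AlgebraicGeometry.Resolution.FormalBranchDescent
import Literature.AlgebraicGeometry.Resolution.ColonIdealSheafFG
import Literature.AlgebraicGeometry.Resolution.BlowupChartMembership
import Literature.AlgebraicGeometry.Resolution.DerivativeIdealsChart
import Literature.AlgebraicGeometry.Resolution.MonomialMarkedIdealsBlowupGeneral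
import HarnessLib

/-!
# Crux `PatchingRelPerfect` (stmt-ResolutionOfSingularities-16161), chain W5.2 — F6 stage 2 («separation»), T6-X2 support
# The REGULAR HOST stays regular (and transversal to the new exceptional divisor) under a blowing up of a centre inside it

[OURS · L1 W5.2 · F6 · T6-X2 brick, second hand for res-D-pv-016 AS w52-stub-5 (owner of `SepFormat` / `stepSepOne_holds`);
F6-DESIGN-MEMO c3041ebc §2.3, TargetsF6 part S v0 078cf7ab §2 docstring «H′ = Bl_C H stays regular»]
Pure PROOFS, format-free (stalk generators + `DepthSNC.SNCWithAt`), no definitions, no named facts; assembly of three tree bricks: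
res-type-049's `SNCWithAt.singleton_of_span_singleton` / `cons_of_stalkIdeal_le` ((L-C), p512894/p513546) and res-D-pv-009's
pointwise transport `IsBlowup.sncWithAt_transform_of_mem_support` (p511317).

For a blowing up `σ : X′ ⟶ X` along `Ĉ` (`X` locally Noetherian), a «host» ideal sheaf `𝓗` and a point `x′` with `x := σ x′`:

* `sncWithAt_singleton_of_generator` — if `𝒪_{X,x}` is regular, the centre is generated at `x` by part of a regular system
  of parameters (`SNCWithAt [] Ĉ x` — e.g. a regular centre in a regular scheme), `𝓗_x = (h)` with `h ∈ 𝔪_x ∖ 𝔪_x²` and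
  `𝓗_x ⊆ Ĉ_x` (the centre lies in the host near `x`), then `SNCWithAt [𝓗] Ĉ x` (ONE parameter exchange);
* **`sncWithAt_strictTransform_host`** — then at every `x′` over `x`:
  `SNCWithAt [strictTransformIdeal σ Ĉ 𝓗, Ĉ.comap σ] ⊤ x′` — the strict transform `H′` of the host is cut out at `x′` by a
  REGULAR PARAMETER of the regular ring `𝒪_{X′,x′}` (wherever `x′ ∈ H′`) and is TRANSVERSAL there to the exceptional divisor;
  `sncWithAt_strictTransform_host_of_not_mem_support` — the same off `V(Ĉ)` from `SNCWithAt [𝓗] ⊤ x`;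
* `exists_generator_not_mem_sq_of_sncWithAt` — reading a regular-parameter generator off `SNCWithAt`: for a member `D ∋ x`
  of an snc family at `x`, `D_x = (v)` with `v ∈ 𝔪_x ∖ 𝔪_x²`; whence
  **`exists_generator_not_mem_sq_strictTransform_host`**: under the hypotheses above, at every `x′ ∈ V(strictTransformIdeal σ Ĉ 𝓗)`
  over `x` the strict transform has a generator in `𝔪_{x′} ∖ 𝔪_{x′}²` — res-D-pv-016's clause (c) of `SepFormat` one step up;
* the POINTWISE bridge to the weight-one CONTROLLED transform (the host of `HostMonoFormat.step` at `ν = 1`), with NO global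
  hypothesis on the order of `𝓗` along the centre: `map_stalkIdeal_host_eq_mul` (`σ^*𝓗 = H′·𝓘_exc` on the stalk, from the chart
  data at the point), **`stalkIdeal_controlledTransform_one_host_eq`** (`σᶜ(𝓗,1)_{x′} = (strictTransformIdeal σ Ĉ 𝓗)_{x′}`), and
  the controlled-transform forms `exists_generator_not_mem_sq_controlledTransform_one_host'` (hypothesis-free) /
  `exists_generator_not_mem_sq_controlledTransform_one_host` and `sncWithAt_controlledTransform_one_host` (given the global
  identification `strictTransformIdeal = controlledTransform … 1`, e.g. from res-D-pv-026's (L-A)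
  `IsBlowup.strictTransformIdeal_eq_controlledTransform`).

AI-written; AI review is weaker than expert review. Nothing here is a statement of the manuscript under review.

## References
* J. Kollár, *Lectures on Resolution of Singularities* (2007), Def. 3.25, 3.104 Step 2.1. [Kollar2007]
* H. Matsumura, *Commutative Ring Theory* (1986), Thm. 14.2, Thm. 17.10. [Matsumura1987]
-/

-- `Summit.<Summit>.<Sub>.Theorems` with `Sub = Summit` (single-conjunct summit, D-0017)
set_option linter.dupNamespace false

noncomputable section

open CategoryTheory CategoryTheory.Limits AlgebraicGeometry TopologicalSpace IsLocalRing
open Literature.AlgebraicGeometry.Resolution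

namespace Summit.ResolutionOfSingularities.ResolutionOfSingularities.Theorems.DepthSNC

universe u

variable {X : Scheme.{u}} {C 𝓗 : X.IdealSheafData} {x : X}

/-- **A host of order one containing the centre is snc WITH the centre at the point** (one parameter exchange):
`𝒪_{X,x}` regular with `Ĉ_x` generated by part of a regular system of parameters (`SNCWithAt [] Ĉ x`), `𝓗_x = (h)` with
`h ∈ 𝔪_x ∖ 𝔪_x²`, `𝓗_x ⊆ Ĉ_x` ⟹ `SNCWithAt [𝓗] Ĉ x`. [cite: Kollar2007, 3.104 Step 2.1] [cite: Matsumura1987, Thm. 14.2] -/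
theorem sncWithAt_singleton_of_generator (hC : SNCWithAt [] C x) {h : X.presheaf.stalk x}
    (h𝓗x : stalkIdeal 𝓗 x = Ideal.span {h}) (hh : h ∈ maximalIdeal (X.presheaf.stalk x))
    (hh2 : h ∉ maximalIdeal (X.presheaf.stalk x) ^ 2) (hle : stalkIdeal 𝓗 x ≤ stalkIdeal C x) :
    SNCWithAt [𝓗] C x :=
  SNCWithAt.cons_of_stalkIdeal_le (𝒦 := []) (𝒦' := []) hC
    (SNCWithAt.singleton_of_span_singleton hC.isRegularLocalRing h𝓗x hh hh2) hle (fun B hB _ => by simp at hB)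

/-- **Reading a regular-parameter generator off `SNCWithAt`**: a member `D` through `x` of a family with simple normal crossings
at `x` has `D_x = (v)` for some `v ∈ 𝔪_x ∖ 𝔪_x²` (a member of a regular system of parameters; Matsumura 17.10 for `v ∉ 𝔪²`).
[cite: Matsumura1987, Thm. 14.2, Thm. 17.10] -/
theorem exists_generator_not_mem_sq_of_sncWithAt {E : List X.IdealSheafData} (hE : SNCWithAt E C x) {D : X.IdealSheafData}
    (hD : D ∈ E) (hxD : x ∈ D.support) :
    ∃ v : X.presheaf.stalk x, stalkIdeal D x = Ideal.span {v} ∧ v ∈ maximalIdeal (X.presheaf.stalk x) ∧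
      v ∉ maximalIdeal (X.presheaf.stalk x) ^ 2 := by
  obtain ⟨hreg, d, v, hd, hv, ⟨ι, -, hιD⟩, -⟩ := hE
  haveI := hreg
  refine ⟨v (ι ⟨D, hD, hxD⟩), hιD ⟨D, hD, hxD⟩, ?_, ?_⟩
  · rw [← hv]; exact Ideal.subset_span ⟨_, rfl⟩
  · have hdim : ringKrullDim (X.presheaf.stalk x) = (d : WithBot ℕ∞) := by
      rw [← hd]
      exact (IsRegularLocalRing.spanFinrank_maximalIdeal (R := X.presheaf.stalk x)).symm
    exact not_mem_sq_of_rsop v hv hdim _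

variable [IsLocallyNoetherian X] {X' : Scheme.{u}} {σ : X' ⟶ X}

/-- **THE REGULAR HOST STAYS REGULAR AND BECOMES TRANSVERSAL TO THE EXCEPTIONAL DIVISOR** (F6 stage 2, one weight-one step, at
a point over the centre): `σ` a blowing up along `Ĉ`, `x′` over `x = σ x′ ∈ V(Ĉ)`, `SNCWithAt [] Ĉ x`, `𝓗_x = (h)` with
`h ∈ 𝔪_x ∖ 𝔪_x²`, `𝓗_x ⊆ Ĉ_x` ⟹ `SNCWithAt [strictTransformIdeal σ Ĉ 𝓗, Ĉ𝒪_{X′}] ⊤ x′`. [cite: Kollar2007, Def. 3.25, 3.104 Step 2.1] -/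
theorem sncWithAt_strictTransform_host (hσ : IsBlowup σ C) (x' : X') (hxC : σ.base x' ∈ C.support)
    (hC : SNCWithAt [] C (σ.base x')) {h : X.presheaf.stalk (σ.base x')}
    (h𝓗x : stalkIdeal 𝓗 (σ.base x') = Ideal.span {h}) (hh : h ∈ maximalIdeal (X.presheaf.stalk (σ.base x')))
    (hh2 : h ∉ maximalIdeal (X.presheaf.stalk (σ.base x')) ^ 2) (hle : stalkIdeal 𝓗 (σ.base x') ≤ stalkIdeal C (σ.base x')) :
    SNCWithAt [strictTransformIdeal σ C 𝓗, C.comap σ] ⊤ x' := by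
  have h1 := hσ.sncWithAt_transform_of_mem_support x' (sncWithAt_singleton_of_generator hC h𝓗x hh hh2 hle) hxC
  simpa only [List.map_cons, List.map_nil, List.singleton_append] using h1

/-- **Off the centre** the blowing up is a local isomorphism: `SNCWithAt [𝓗] ⊤ x` at `x = σ x′ ∉ V(Ĉ)` gives
`SNCWithAt [strictTransformIdeal σ Ĉ 𝓗, Ĉ𝒪_{X′}] ⊤ x′`. [cite: Kollar2007, Def. 3.25] -/
theorem sncWithAt_strictTransform_host_of_not_mem_support (hσ : IsBlowup σ C) (x' : X')
    (hxC : σ.base x' ∉ C.support) (h𝓗 : SNCWithAt [𝓗] ⊤ (σ.base x')) :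
    SNCWithAt [strictTransformIdeal σ C 𝓗, C.comap σ] ⊤ x' := by
  haveI : IsProper σ := hσ.isProper
  haveI : IsLocallyNoetherian X' := LocallyOfFiniteType.isLocallyNoetherian σ
  have h1 := (hσ.sncWithAt_transform_of_not_mem_support x' (h𝓗.of_not_mem_support hxC) hxC).top
  simpa only [List.map_cons, List.map_nil, List.singleton_append] using h1

/-- **Generator form, one step up**: under the hypotheses of `sncWithAt_strictTransform_host`, at every point `x′` of the
strict transform `H′ = V(strictTransformIdeal σ Ĉ 𝓗)` over `x` its stalk is `(h′)` with `h′ ∈ 𝔪_{x′} ∖ 𝔪_{x′}²` — the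
host is again cut out by a regular parameter (res-D-pv-016's `SepFormat` clause (c) for the transformed state).
[cite: Matsumura1987, Thm. 14.2] [cite: Kollar2007, 3.104 Step 2.1] -/
theorem exists_generator_not_mem_sq_strictTransform_host (hσ : IsBlowup σ C) (x' : X') (hxC : σ.base x' ∈ C.support)
    (hC : SNCWithAt [] C (σ.base x')) {h : X.presheaf.stalk (σ.base x')}
    (h𝓗x : stalkIdeal 𝓗 (σ.base x') = Ideal.span {h}) (hh : h ∈ maximalIdeal (X.presheaf.stalk (σ.base x')))
    (hh2 : h ∉ maximalIdeal (X.presheaf.stalk (σ.base x')) ^ 2) (hle : stalkIdeal 𝓗 (σ.base x') ≤ stalkIdeal C (σ.base x'))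
    (hx' : x' ∈ (strictTransformIdeal σ C 𝓗).support) :
    ∃ h' : X'.presheaf.stalk x', stalkIdeal (strictTransformIdeal σ C 𝓗) x' = Ideal.span {h'} ∧
      h' ∈ maximalIdeal (X'.presheaf.stalk x') ∧ h' ∉ maximalIdeal (X'.presheaf.stalk x') ^ 2 :=
  exists_generator_not_mem_sq_of_sncWithAt (sncWithAt_strictTransform_host hσ x' hxC hC h𝓗x hh hh2 hle)
    List.mem_cons_self hx'

/-- **The strict transform of the host is transversal to the exceptional divisor** at every common point over `x`
(`SNCWithAt [H′, Ĉ𝒪] ⊤ x′` read as the pair being part of one regular system of parameters): the «`𝓗′ ⋔ G_new`» half of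
res-D-pv-016's transversality clause (d), for free. [cite: Kollar2007, Def. 3.25] -/
theorem sncWithAt_pair_strictTransform_host_exceptional (hσ : IsBlowup σ C) (x' : X') (hxC : σ.base x' ∈ C.support)
    (hC : SNCWithAt [] C (σ.base x')) {h : X.presheaf.stalk (σ.base x')}
    (h𝓗x : stalkIdeal 𝓗 (σ.base x') = Ideal.span {h}) (hh : h ∈ maximalIdeal (X.presheaf.stalk (σ.base x')))
    (hh2 : h ∉ maximalIdeal (X.presheaf.stalk (σ.base x')) ^ 2) (hle : stalkIdeal 𝓗 (σ.base x') ≤ stalkIdeal C (σ.base x')) :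
    SNCWithAt [C.comap σ, strictTransformIdeal σ C 𝓗] ⊤ x' :=
  (sncWithAt_strictTransform_host hσ x' hxC hC h𝓗x hh hh2 hle).congr_mem fun D _ => by
    simp only [List.mem_cons, List.mem_nil_iff, or_false]; tauto

/-- **Controlled-transform (weight one) form**: when the strict transform of the host IS its weight-one controlled transform
(an effective Cartier host of generic order one along the centre: res-D-pv-026's (L-A)
`IsBlowup.strictTransformIdeal_eq_controlledTransform`, taken here as the hypothesis `hst`), the host `σᶜ(𝓗, 1)` of the
transformed state (`HostMonoFormat.step` with `ν = 1`) is cut out at every point `x′ ∈ V(σᶜ(𝓗,1))` over `x` by a regular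
parameter. [cite: Kollar2007, 3.30.2, 3.104 Step 2.1] -/
theorem exists_generator_not_mem_sq_controlledTransform_one_host (hσ : IsBlowup σ C) (x' : X')
    (hxC : σ.base x' ∈ C.support) (hC : SNCWithAt [] C (σ.base x')) {h : X.presheaf.stalk (σ.base x')}
    (h𝓗x : stalkIdeal 𝓗 (σ.base x') = Ideal.span {h}) (hh : h ∈ maximalIdeal (X.presheaf.stalk (σ.base x')))
    (hh2 : h ∉ maximalIdeal (X.presheaf.stalk (σ.base x')) ^ 2) (hle : stalkIdeal 𝓗 (σ.base x') ≤ stalkIdeal C (σ.base x'))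
    (hst : strictTransformIdeal σ C 𝓗 = controlledTransform σ C 𝓗 1)
    (hx' : x' ∈ (controlledTransform σ C 𝓗 1).support) :
    ∃ h' : X'.presheaf.stalk x', stalkIdeal (controlledTransform σ C 𝓗 1) x' = Ideal.span {h'} ∧
      h' ∈ maximalIdeal (X'.presheaf.stalk x') ∧ h' ∉ maximalIdeal (X'.presheaf.stalk x') ^ 2 := by
  rw [← hst] at hx' ⊢
  exact exists_generator_not_mem_sq_strictTransform_host hσ x' hxC hC h𝓗x hh hh2 hle hx'

/-- **Controlled-transform form of the transversality**: `SNCWithAt [σᶜ(𝓗,1), Ĉ𝒪] ⊤ x′` under the same identification.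
[cite: Kollar2007, Def. 3.25] -/
theorem sncWithAt_controlledTransform_one_host (hσ : IsBlowup σ C) (x' : X') (hxC : σ.base x' ∈ C.support)
    (hC : SNCWithAt [] C (σ.base x')) {h : X.presheaf.stalk (σ.base x')}
    (h𝓗x : stalkIdeal 𝓗 (σ.base x') = Ideal.span {h}) (hh : h ∈ maximalIdeal (X.presheaf.stalk (σ.base x')))
    (hh2 : h ∉ maximalIdeal (X.presheaf.stalk (σ.base x')) ^ 2) (hle : stalkIdeal 𝓗 (σ.base x') ≤ stalkIdeal C (σ.base x'))
    (hst : strictTransformIdeal σ C 𝓗 = controlledTransform σ C 𝓗 1) :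
    SNCWithAt [controlledTransform σ C 𝓗 1, C.comap σ] ⊤ x' := by
  rw [← hst]
  exact sncWithAt_strictTransform_host hσ x' hxC hC h𝓗x hh hh2 hle

/-! ## Weight-one controlled transform = strict transform of the host, POINTWISE over the centre -/

set_option maxHeartbeats 400000 in
/-- **`σ^*𝓗 = H′ · 𝓘_exc` on the stalk at `x′`** (pointwise form of the tree's `map_stalkIdeal_eq_mul_of_stalkIdeal_le`, which
asks the GLOBAL `HasSNCWith`): at a point `x′` over `x ∈ V(Ĉ)` with `SNCWithAt [𝓗] Ĉ x`, `x ∈ V(𝓗)` and `𝓗_x ⊆ Ĉ_x`, the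
total transform of the host factors on the stalk as the strict transform times the exceptional ideal (chart data at the point:
`𝓗_x = (x_j)`, `φ(x_j) = φ(x_i)·e_j`). [cite: Kollar2007, (3.111) Step 1, Def. 3.25] -/
theorem map_stalkIdeal_host_eq_mul (hσ : IsBlowup σ C) (x' : X') (hxC : σ.base x' ∈ C.support)
    (h𝓗 : SNCWithAt [𝓗] C (σ.base x')) (hx : σ.base x' ∈ 𝓗.support)
    (hle : stalkIdeal 𝓗 (σ.base x') ≤ stalkIdeal C (σ.base x')) :
    (stalkIdeal 𝓗 (σ.base x')).map (σ.stalkMap x').hom =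
      stalkIdeal (strictTransformIdeal σ C 𝓗) x' * stalkIdeal (C.comap σ) x' := by
  haveI : IsProper σ := hσ.isProper
  haveI : IsLocallyNoetherian X' := LocallyOfFiniteType.isLocallyNoetherian σ
  obtain ⟨D, τ, -, hτ⟩ := exists_chartData_of_sncWithAt hσ x' h𝓗 hxC
  letI := D.algB
  obtain ⟨j, hj⟩ := D.exists_eq_inl_of_stalkIdeal_le τ hτ ⟨𝓗, List.mem_cons_self, hx⟩ hle
  have hKx : stalkIdeal 𝓗 (σ.base x') = Ideal.span {(X.presheaf.germ D.U (σ.base x') D.hxU).hom (D.x j)} := by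
    rw [hτ ⟨𝓗, List.mem_cons_self, hx⟩, hj, Sum.elim_inl]
  -- `φ(x_j) = φ(x_i) · e_j` read in the stalk
  have hmul : D.toStalk (reesChartBase (D.x D.i) (Ideal.mem_span_range_self (f := D.x) (x := D.i)) (D.x j)) =
      D.toStalk (reesChartBase (D.x D.i) (Ideal.mem_span_range_self (f := D.x) (x := D.i)) (D.x D.i)) *
        D.toStalk (D.gen j) := by
    have h := congrArg D.toStalk (reesChartBase_apply_eq_mul_chartGen D.x D.i j)
    refine h.trans ?_
    rw [D.toStalk_eq, D.toStalk_eq, D.toStalk_eq, map_mul]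
  rw [D.stalkIdeal_exceptional hxC, hKx, Ideal.map_span, Set.image_singleton, ← D.algebraMap_reesChartBase,
    ← D.toStalk_eq]
  by_cases hji : j = D.i
  · subst hji
    rw [D.stalkIdeal_strictTransform_x_self hxC 𝓗 hKx, Ideal.top_mul]
  · rw [D.stalkIdeal_strictTransform_x hxC 𝓗 hji hKx, Ideal.span_singleton_mul_span_singleton]
    exact congrArg (fun t => Ideal.span {t}) (hmul.trans (mul_comm _ _))

/-- **On the stalk at `x′`, the weight-one controlled transform of the host IS its strict transform** (no global hypothesis on
the order of `𝓗` along the centre): `σᶜ(𝓗,1)_{x′} = ((σ^*𝓗)_{x′} : 𝓘_exc,x′) = (H′_{x′}·(e) : (e)) = H′_{x′}`, the local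
equation `e` of the exceptional divisor being a nonzerodivisor. [cite: BierstoneGrigorievMilmanWlodarczyk2011, §3.2]
[cite: Kollar2007, 3.30.2] -/
theorem stalkIdeal_controlledTransform_one_host_eq (hσ : IsBlowup σ C) (x' : X') (hxC : σ.base x' ∈ C.support)
    (h𝓗 : SNCWithAt [𝓗] C (σ.base x')) (hx : σ.base x' ∈ 𝓗.support)
    (hle : stalkIdeal 𝓗 (σ.base x') ≤ stalkIdeal C (σ.base x')) :
    stalkIdeal (controlledTransform σ C 𝓗 1) x' = stalkIdeal (strictTransformIdeal σ C 𝓗) x' := by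
  obtain ⟨e, he, hexc⟩ := IsEffectiveCartier.exists_stalkIdeal_eq_span hσ.isEffectiveCartier x'
  rw [hσ.stalkIdeal_controlledTransform, pow_one, stalkIdeal_comap_eq_map_stalkMap,
    map_stalkIdeal_host_eq_mul hσ x' hxC h𝓗 hx hle, hexc, mul_comm, Submodule.colon_span]
  exact colon_span_singleton_mul_eq he _

/-- **Clause (c) one step up, controlled-transform form, hypothesis-free**: under the hypotheses of
`sncWithAt_strictTransform_host`, at every `x′ ∈ V(σᶜ(𝓗,1))` over `x` the weight-one controlled transform of the host has a
generator in `𝔪_{x′} ∖ 𝔪_{x′}²` (for `HostMonoFormat.step` at `ν = 1`). [cite: Kollar2007, 3.30.2, 3.104 Step 2.1] -/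
theorem exists_generator_not_mem_sq_controlledTransform_one_host' (hσ : IsBlowup σ C) (x' : X')
    (hxC : σ.base x' ∈ C.support) (hC : SNCWithAt [] C (σ.base x')) {h : X.presheaf.stalk (σ.base x')}
    (h𝓗x : stalkIdeal 𝓗 (σ.base x') = Ideal.span {h}) (hh : h ∈ maximalIdeal (X.presheaf.stalk (σ.base x')))
    (hh2 : h ∉ maximalIdeal (X.presheaf.stalk (σ.base x')) ^ 2) (hle : stalkIdeal 𝓗 (σ.base x') ≤ stalkIdeal C (σ.base x'))
    (hx' : x' ∈ (controlledTransform σ C 𝓗 1).support) :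
    ∃ h' : X'.presheaf.stalk x', stalkIdeal (controlledTransform σ C 𝓗 1) x' = Ideal.span {h'} ∧
      h' ∈ maximalIdeal (X'.presheaf.stalk x') ∧ h' ∉ maximalIdeal (X'.presheaf.stalk x') ^ 2 := by
  have hx : σ.base x' ∈ 𝓗.support := by
    rw [mem_support_iff_stalkIdeal_le, h𝓗x, Ideal.span_singleton_le_iff_mem]; exact hh
  have hsnc := sncWithAt_singleton_of_generator hC h𝓗x hh hh2 hle
  have heq := stalkIdeal_controlledTransform_one_host_eq hσ x' hxC hsnc hx hle
  have hx'' : x' ∈ (strictTransformIdeal σ C 𝓗).support := by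
    rw [mem_support_iff_stalkIdeal_le, ← heq]; exact (mem_support_iff_stalkIdeal_le _ _).mp hx'
  rw [heq]
  exact exists_generator_not_mem_sq_strictTransform_host hσ x' hxC hC h𝓗x hh hh2 hle hx''

end Summit.ResolutionOfSingularities.ResolutionOfSingularities.Theorems.DepthSNC

end
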